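import Mathlib
import Summits.ResolutionOfSingularities.ResolutionOfSingularities.Theorems.WeightedInvariantLocalWeightedDropMonicDescentBridgeSlices
import Summits.ResolutionOfSingularities.ResolutionOfSingularities.Theorems.WeightedInvariantLocalWeightedDropMonicDescentSingularTransfer
import Summits.ResolutionOfSingularities.ResolutionOfSingularities.Theorems.WeightedInvariantLocalWeightedDropConeDichotomy
import Summits.ResolutionOfSingularities.ResolutionOfSingularities.Theorems.WeightedInvariantLocalWeightedDropWeierstrassForm

/-!
# `WeightedInvariant.LocalWeightedDrop`, sub-stub `stub_monicDoublePointDescends`, piece T-6′ (game bridge), part 4: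
# THE HYPERBOLIC EXIT — a singular slice re-presented by a WELL-PREPARED label is a position or hyperbolic

Crux item stmt-ResolutionOfSingularities-8899 `LocalWeightedDrop` (route `ResolutionOfSingularities/WeightedInvariant`), door
`HypersurfaceCentreConstruction` stmt-ResolutionOfSingularities-19897.  [OURS · L1 W4.3, chain w43, seat res-type-056 (T-6′ per SEAT TABLE v6);
tools for the hypothesis hT6 of `MonicDescent.descends_of_pieces` (p488513).  Nothing here is a statement of any manuscript.]

`isPosition_or_isHyperbolic_of_represents` (`k` algebraically closed of characteristic `2`): if a SINGULAR germ `S` is formally re-presented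
(`Represents S X₀ X₁`) by a WELL-PREPARED label `X`, then `X` is a position or `S` is hyperbolic (`MonicDescent.IsHyperbolic`, the exit of the
descent game).  Proof:
* `two_le_order_pos_of_represents` (res-L1-w43-lead-1's `…SingularTransfer`) — `S ∈ 𝔪²` forces `pos X ∈ 𝔪²`, so every point of the scaled
  Newton set of `X` has degree `≥ 2` (`two_le_sum_of_two_le_order_pos`);
* `exists_isVertex_of_degree_two` — if some point has degree `2`, the one with least first coordinate is a VERTEX (weight `(4,3)`); by
  well-preparedness it is ODD: `2e` with `e` a linear exponent of `X₁` (cross term `u_i·y` of `pos X`), or `(1,1)` (cross term `u₁u₂`);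
* `cross_coeff_subst_eq_zero_of_sq` — if the degree-`2` part of a germ in `𝔪²` is the square of a linear form, then after ANY formal coordinate change
  (zero constant terms, invertible linear part) every cross coefficient `X_aX_b`, `a ≠ b`, still vanishes (normalise `θ = L ∘ ψ` with `ψ`
  tangent to the identity — `FormalCoordChange.subst_eq_subst_normalize`, `TangentId.coeff_subst_of_degree_le`; the linear part acts by
  congruence — `stub_coneDichotomyQuadSubst` — and the polar form of the rank-one matrix `ℓℓᵀ` is `2(v·ℓ)(w·ℓ) = 0` in characteristic `2`);
* so the square alternative of `stub_coneDichotomy` for `S` contradicts the cross term of `θ^*S = H · pos X` (`coeff_mul_of_two_le_order`),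
  and `S` is hyperbolic.
-/

set_option linter.dupNamespace false -- mandated namespace of this single-conjunct summit

noncomputable section

namespace Summit.ResolutionOfSingularities.ResolutionOfSingularities.Theorems

namespace MonicDescent

open MvPowerSeries Literature.RingTheory.TwoVariableSeries Literature.AlgebraicGeometry.Resolution

variable {k : Type} [Field k]

/-! ## Coefficients of `pos` in degree `≤ 2` -/

/-- The cylinder embedding `Fin 2 ↪ Fin 3` along the last slot, on exponents: `e ↦ (e₀, e₁, 0)`. -/
theorem embDomain_succAboveEmb_last_two (β : Fin 2 →₀ ℕ) :
    Finsupp.embDomain (Fin.succAboveEmb (Fin.last 2)) β = Finsupp.single 0 (β 0) + Finsupp.single 1 (β 1) := by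
  classical
  have hβ : β = Finsupp.single 0 (β 0) + Finsupp.single 1 (β 1) := finsupp_fin2_ext (by simp) (by simp)
  conv_lhs => rw [hβ]
  rw [Finsupp.embDomain_add, Finsupp.embDomain_single, Finsupp.embDomain_single]
  have h0 : (Fin.succAboveEmb (Fin.last 2)) (0 : Fin 2) = (0 : Fin 3) := by decide
  have h1 : (Fin.succAboveEmb (Fin.last 2)) (1 : Fin 2) = (1 : Fin 3) := by decide
  rw [h0, h1]

/-- `coeff (β, n) (pos X₀ X₁)` for `n ≤ 1`: the coefficient of `X₀` (`n = 0`) resp. `X₁` (`n = 1`). -/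
theorem coeff_pos_of_le_one (X₀ X₁ : MvPowerSeries (Fin 2) k) (β : Fin 2 →₀ ℕ) (n : ℕ) (hn : n ≤ 1) :
    coeff (Finsupp.embDomain (Fin.succAboveEmb (Fin.last 2)) β + Finsupp.single (Fin.last 2) n) (pos X₀ X₁) =
      if n = 0 then coeff β X₀ else coeff β X₁ := by
  rw [pos_eq_monicForm, WeierstrassForm.coeff_monicForm, if_neg (by omega), zero_add, Fin.sum_univ_two]
  simp only [Fin.val_zero, Fin.val_one, Matrix.cons_val_zero, Matrix.cons_val_one]
  rcases Nat.le_one_iff_eq_zero_or_eq_one.mp hn with rfl | rfl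
  · simp
  · simp

/-- If `pos X ∈ 𝔪²` then every point of the scaled Newton set of `X` has degree `≥ 2`. -/
theorem two_le_sum_of_two_le_order_pos {X₀ X₁ : MvPowerSeries (Fin 2) k} (h : (2 : ℕ∞) ≤ (pos X₀ X₁).order) :
    ∀ P ∈ newtonSet X₀ X₁, 2 ≤ P 0 + P 1 := by
  intro P hP
  by_contra hlt
  push Not at hlt
  rcases hP with hP | ⟨e, rfl, he⟩
  · apply hP
    have h0 := coeff_pos_of_le_one X₀ X₁ P 0 (by omega)
    rw [if_pos rfl, Finsupp.single_zero, add_zero] at h0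
    rw [← h0]
    apply coeff_of_lt_order
    refine lt_of_lt_of_le ?_ h
    have hdeg : (Finsupp.embDomain (Fin.succAboveEmb (Fin.last 2)) P).degree = P 0 + P 1 := by
      rw [embDomain_succAboveEmb_last_two, map_add, Finsupp.degree_single, Finsupp.degree_single]
    rw [hdeg]
    exact_mod_cast hlt
  · apply he
    have h1 := coeff_pos_of_le_one X₀ X₁ e 1 le_rfl
    rw [if_neg one_ne_zero] at h1
    rw [← h1]
    apply coeff_of_lt_order
    refine lt_of_lt_of_le ?_ h
    have hdeg : (Finsupp.embDomain (Fin.succAboveEmb (Fin.last 2)) e + Finsupp.single (Fin.last 2) 1).degree = e 0 + e 1 + 1 := by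
      rw [map_add, embDomain_succAboveEmb_last_two, map_add, Finsupp.degree_single, Finsupp.degree_single,
        Finsupp.degree_single]
    rw [hdeg]
    have : e 0 + e 1 + 1 < 2 := by
      simp only [Finsupp.smul_apply, smul_eq_mul] at hlt
      omega
    exact_mod_cast this

/-! ## A degree-2 point makes an odd vertex, hence a cross term -/

/-- If all points of `N ⊂ ℕ²` have degree `≥ 2` and some point has degree `≤ 2`, then some point OF DEGREE `2` is a VERTEX (the one with least
first coordinate; weight `(4,3)`). -/
theorem exists_isVertex_of_degree_two {N : Set (Fin 2 →₀ ℕ)} (hN : ∀ P ∈ N, 2 ≤ P 0 + P 1) (hlow : ∃ P ∈ N, P 0 + P 1 ≤ 2) :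
    ∃ P, IsVertex N P ∧ P 0 + P 1 = 2 := by
  classical
  have hex : ∃ m, ∃ P ∈ N, P 0 + P 1 = 2 ∧ P 0 = m := by
    obtain ⟨P, hP, hle⟩ := hlow
    exact ⟨P 0, P, hP, le_antisymm hle (hN P hP), rfl⟩
  obtain ⟨P, hP, hP2, hPm⟩ := Nat.find_spec hex
  have hmin : ∀ Q ∈ N, Q 0 + Q 1 = 2 → P 0 ≤ Q 0 := by
    intro Q hQ hQ2
    rw [hPm]
    exact Nat.find_min' hex ⟨Q, hQ, hQ2, rfl⟩
  refine ⟨P, ⟨hP, ![4, 3], ?_, ?_⟩, hP2⟩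
  · intro i; fin_cases i <;> simp
  · intro Q hQ hne
    have hw : ∀ R : Fin 2 →₀ ℕ, Finsupp.weight ![4, 3] R = 4 * R 0 + 3 * R 1 := by
      intro R
      rw [Finsupp.weight_apply, Finsupp.sum_fintype _ _ (by simp), Fin.sum_univ_two]
      simp [mul_comm]
    rw [hw, hw]
    have hQ2 := hN Q hQ
    by_cases hQeq : Q 0 + Q 1 = 2
    · have hle := hmin Q hQ hQeq
      have hne0 : Q 0 ≠ P 0 := by
        intro h0
        apply hne
        exact finsupp_fin2_ext h0 (by omega)
      omega
    · omega

/-- A WELL-PREPARED label with `pos X ∈ 𝔪²` which is NOT a position has a CROSS TERM in `pos X`: a non-zero coefficient on `X_a X_b`, `a ≠ b`. -/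
theorem exists_cross_coeff_pos {X₀ X₁ : MvPowerSeries (Fin 2) k} (hWP : WellPrepared X₀ X₁) (h2 : (2 : ℕ∞) ≤ (pos X₀ X₁).order)
    (hnot : ¬ IsPosition X₀ X₁) :
    ∃ a b : Fin 3, a ≠ b ∧ coeff (Finsupp.single a 1 + Finsupp.single b 1) (pos X₀ X₁) ≠ 0 := by
  classical
  have hN := two_le_sum_of_two_le_order_pos h2
  -- a point of degree ≤ 2
  have hlow : ∃ P ∈ newtonSet X₀ X₁, P 0 + P 1 ≤ 2 := by
    by_contra hno
    push Not at hno
    apply hnot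
    constructor
    · apply lt_of_lt_of_le (by norm_num : (2 : ℕ∞) < 3)
      apply MvPowerSeries.le_order
      intro d hd
      by_contra hne
      have := hno d (Or.inl hne)
      have hdeg : Finsupp.degree d = d 0 + d 1 := by rw [Finsupp.degree_eq_sum]; simp [Fin.sum_univ_two]
      rw [hdeg] at hd
      exact absurd this (not_le.mpr (by exact_mod_cast hd))
    · apply lt_of_lt_of_le (by norm_num : (1 : ℕ∞) < 2)
      apply MvPowerSeries.le_order
      intro d hd
      by_contra hne
      have := hno (2 • d) (Or.inr ⟨d, rfl, hne⟩)
      simp only [Finsupp.smul_apply, smul_eq_mul] at this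
      have hdeg : Finsupp.degree d = d 0 + d 1 := by rw [Finsupp.degree_eq_sum]; simp [Fin.sum_univ_two]
      rw [hdeg] at hd
      have : d 0 + d 1 < 2 := by exact_mod_cast hd
      omega
  obtain ⟨P, hPv, hP2⟩ := exists_isVertex_of_degree_two hN hlow
  rcases hWP P hPv with ⟨e, rfl, he⟩ | ⟨hP, i, hi⟩
  · -- P = 2e, e a linear exponent of X₁: cross term u_i · y
    simp only [Finsupp.smul_apply, smul_eq_mul] at hP2
    have he1 : e 0 + e 1 = 1 := by omega
    obtain ⟨i, hei⟩ : ∃ i : Fin 2, e = Finsupp.single i 1 := by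
      by_cases h0 : e 0 = 1
      · exact ⟨0, finsupp_fin2_ext (by simp [h0]) (by simp; omega)⟩
      · exact ⟨1, finsupp_fin2_ext (by simp; omega) (by simp; omega)⟩
    refine ⟨Fin.castSucc i, Fin.last 2, (Fin.castSucc_lt_last i).ne, ?_⟩
    have h1 := coeff_pos_of_le_one X₀ X₁ e 1 le_rfl
    rw [if_neg one_ne_zero] at h1
    rw [hei] at h1 he
    rw [Finsupp.embDomain_single] at h1
    have hidx : (Fin.succAboveEmb (Fin.last 2)) i = Fin.castSucc i := by
      rw [Fin.coe_succAboveEmb, Fin.succAbove_last]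
    rw [hidx] at h1
    rw [h1]
    exact he
  · -- P an exponent of X₀ of degree 2 with an odd coordinate: P = (1,1), cross term u₁u₂
    have hP11 : P = Finsupp.single 0 1 + Finsupp.single 1 1 := by
      have hodd : P i = 1 := by
        have hle : P i ≤ P 0 + P 1 := by fin_cases i <;> simp
        have h2 : P i % 2 = 1 := Nat.two_dvd_ne_zero.mp hi
        omega
      fin_cases i
      · exact finsupp_fin2_ext (by simp at hodd ⊢; omega) (by simp at hodd ⊢; omega)
      · exact finsupp_fin2_ext (by simp at hodd ⊢; omega) (by simp at hodd ⊢; omega)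
    refine ⟨0, 1, by decide, ?_⟩
    have h0 := coeff_pos_of_le_one X₀ X₁ P 0 (by omega)
    rw [if_pos rfl, Finsupp.single_zero, add_zero, embDomain_succAboveEmb_last_two, hP11] at h0
    simp only [Finsupp.add_apply, Finsupp.single_apply] at h0
    simp at h0
    rw [h0, ← hP11]
    exact hP

/-! ## Squares of linear forms have no cross terms, after any formal coordinate change -/

/-- In characteristic `2` the polar form of a rank-one matrix `ℓℓᵀ` vanishes: `v·(ℓℓᵀ)w + w·(ℓℓᵀ)v = 2(v·ℓ)(w·ℓ) = 0`. -/
theorem polar_rankOne_eq_zero [CharP k 2] {N : ℕ} (ℓ v w : Fin N → k) :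
    dotProduct v ((Matrix.of fun a b => ℓ a * ℓ b).mulVec w) + dotProduct w ((Matrix.of fun a b => ℓ a * ℓ b).mulVec v) = 0 := by
  have hsym : dotProduct v ((Matrix.of fun a b => ℓ a * ℓ b).mulVec w) =
      dotProduct w ((Matrix.of fun a b => ℓ a * ℓ b).mulVec v) := by
    rw [ConeDichotomy.dotProduct_mulVec_eq_sum, ConeDichotomy.dotProduct_mulVec_eq_sum, Finset.sum_comm]
    refine Finset.sum_congr rfl fun a _ => Finset.sum_congr rfl fun b _ => ?_
    simp only [Matrix.of_apply]
    ring
  rw [hsym, ← two_mul, show (2 : k) = 0 from CharP.cast_eq_zero k 2, zero_mul]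

/-- If the degree-`2` part of `f ∈ 𝔪²` is the square of a linear form, then for every substitution `θ` with zero constant terms and invertible
linear part, `θ^* f` has NO CROSS TERMS: `coeff (X_a X_b) (θ^* f) = 0` for `a ≠ b` (characteristic `2`). -/
theorem cross_coeff_subst_eq_zero_of_sq [CharP k 2] {N : ℕ} {f : MvPowerSeries (Fin N) k} (hf0 : constantCoeff f = 0)
    (hf1 : ∀ i, coeff (Finsupp.single i 1) f = 0) (ℓ : Fin N → k)
    (hsq : ∀ i j : Fin N, coeff (Finsupp.single i 1 + Finsupp.single j 1) f =
      coeff (Finsupp.single i 1 + Finsupp.single j 1) ((∑ l, C (ℓ l) * X l) ^ 2))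
    {θ : Fin N → MvPowerSeries (Fin N) k} (hθ0 : ∀ i, constantCoeff (θ i) = 0) (hθdet : IsUnit (FormalCoordChange.linMat θ).det)
    {a b : Fin N} (hab : a ≠ b) :
    coeff (Finsupp.single a 1 + Finsupp.single b 1) (subst θ f) = 0 := by
  classical
  set M := FormalCoordChange.linMat θ
  set F := subst (FormalCoordChange.linSubst M) f with hF
  -- the degree-2 coefficients of f are those of the quadratic polynomial of ℓℓᵀ
  have hc : ∀ i j : Fin N, coeff (Finsupp.single i 1 + Finsupp.single j 1) f =
      if i = j then (Matrix.of fun a b => ℓ a * ℓ b) i i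
      else (Matrix.of fun a b => ℓ a * ℓ b) i j + (Matrix.of fun a b => ℓ a * ℓ b) j i := by
    intro i j
    rw [hsq, ConeDichotomy.sq_linear_eq_quadP, ConeDichotomy.coeff_pair_quadP]
  -- the linear part: congruence, polar form of ℓℓᵀ vanishes off the diagonal
  have hFab : coeff (Finsupp.single a 1 + Finsupp.single b 1) F = 0 := by
    rw [hF, stub_coneDichotomyQuadSubst k N M _ f hf0 hf1 hc a b, if_neg hab]
    exact polar_rankOne_eq_zero ℓ _ _
  -- the tangent-to-identity part does not touch degree 2
  have h2f : (2 : ℕ∞) ≤ f.order := (FormalCoordChange.two_le_order_iff f).mpr ⟨hf0, hf1⟩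
  have h2F : (2 : ℕ∞) ≤ F.order :=
    FormalCoordChange.two_le_order_subst _ (ConeDichotomy.constantCoeff_linSubst M) f h2f
  rw [FormalCoordChange.subst_eq_subst_normalize hθ0 hθdet f,
    (FormalCoordChange.tangentId_normalize hθ0 hθdet).coeff_subst_of_degree_le F _ (by
      rw [map_add, Finsupp.degree_single, Finsupp.degree_single]; exact h2F)]
  exact hFab

/-- The degree-`2` coefficients of `H · F` for `F ∈ 𝔪²` are `H(0)` times those of `F`. -/
theorem coeff_mul_of_two_le_order {N : ℕ} (H F : MvPowerSeries (Fin N) k) (hF : (2 : ℕ∞) ≤ F.order) (d : Fin N →₀ ℕ)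
    (hd : d.degree = 2) : coeff d (H * F) = constantCoeff H * coeff d F := by
  classical
  rw [coeff_mul, Finset.sum_eq_single (0, d)]
  · rw [coeff_zero_eq_constantCoeff]
  · rintro ⟨p, q⟩ hpq hne
    rw [Finset.HasAntidiagonal.mem_antidiagonal] at hpq
    dsimp only at hpq ⊢
    by_cases hp : p = 0
    · exfalso
      apply hne
      subst hp
      rw [zero_add] at hpq
      rw [hpq]
    · have hp1 : p.degree ≠ 0 := fun h => hp ((Finsupp.degree_eq_zero_iff p).mp h)
      have hdeg := congrArg Finsupp.degree hpq
      rw [map_add, hd] at hdeg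
      have hlt : q.degree < 2 := by omega
      rw [coeff_of_lt_order (lt_of_lt_of_le (by exact_mod_cast hlt) hF), mul_zero]
  · intro h
    exact absurd (Finset.HasAntidiagonal.mem_antidiagonal.mpr (zero_add d)) h

/-! ## The dichotomy -/

/-- THE HYPERBOLIC EXIT (OURS · L1 W4.3, piece T-6′).  Over an algebraically closed field of characteristic `2`: a SINGULAR germ `S` which is
formally re-presented by a WELL-PREPARED label `(X₀, X₁)` is re-presented by a POSITION, or is HYPERBOLIC. -/
theorem isPosition_or_isHyperbolic_of_represents [CharP k 2] [IsAlgClosed k] {X₀ X₁ : MvPowerSeries (Fin 2) k}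
    (hWP : WellPrepared X₀ X₁) {S : MvPowerSeries (Fin 3) k} (hS : CobordantGame.IsSingular k S) (hrep : Represents S X₀ X₁) :
    IsPosition X₀ X₁ ∨ IsHyperbolic S := by
  classical
  by_cases hpos : IsPosition X₀ X₁
  · exact Or.inl hpos
  right
  have h2 := two_le_order_pos_of_represents hrep hS
  obtain ⟨a, b, hab, hcross⟩ := exists_cross_coeff_pos hWP h2 hpos
  obtain ⟨θ, H, hθ0, hθdet, hH, heq⟩ := hrep
  rcases stub_coneDichotomy k 1 S hS with hhyp | ⟨ℓ, hℓ⟩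
  · exact hhyp
  · exfalso
    apply hcross
    have hzero := cross_coeff_subst_eq_zero_of_sq hS.2.1 hS.2.2 ℓ hℓ hθ0 hθdet hab
    rw [heq, coeff_mul_of_two_le_order H _ h2 _ (by rw [map_add, Finsupp.degree_single, Finsupp.degree_single])] at hzero
    exact (mul_eq_zero.mp hzero).resolve_left hH

end MonicDescent

end Summit.ResolutionOfSingularities.ResolutionOfSingularities.Theorems

end
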